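import Summits.Parity.GeneralizedHardyLittlewood.Theorems.BeyondDiagonalBeatsQuarter.CornerAbel
import HarnessLib

/-!
# Route `PrimeLevelFamEdge`, crux K_A `MomentsBeyondDiagonal` (stmt-Parity-20007), line «petersson_layers» v4, stub `stub_diag`:
# **the two-variable Abel estimate for the corner with log-power weights `ℓ⁺(k₁)ⁱℓ⁺(k₂)ʲ`**

Census item G7 (corner negligible for a general admissible profile) of the `stub_diag` repair census
(`Lines/petersson_layers_stub_diag_g4_bricks.md`), part 1. K_B's `Corner.abs_doubleSum_cornerE_le`
(`CornerAbel`, crux stmt-Parity-20343) bounds the decoupled corner double sum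
`Σ_{k₁,k₂≤Y} a(k₁)a(k₂)ℓ⁺(k₁)²ℓ⁺(k₂)²E(αk₁k₂)` of the `X²` profile; for a general polynomial profile
`P = Σ_c P_c X^c` the corner is the `P_iP_j`-combination of the same sums with weights `ℓ⁺(k₁)ⁱℓ⁺(k₂)ʲ`.
This file proves the estimate for every pair of exponents `i, j ≥ 1` by the same two-regime Abel summation
(rows `k₁ ≤ K₁`: arguments `≤ 2αK₁Y` where `E ≤ √·`; rows `k₁ > K₁`: partial sums `η`-small):

* `abs_doubleSum_cornerE_pow_le` — **`|Σ_{k₁,k₂≤Y} a(k₁)a(k₂)ℓ⁺(k₁)ⁱℓ⁺(k₂)ʲE(αk₁k₂)| ≤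
  Sᵢ·B·2logʲY·√(2αK₁Y) + Sⱼ·2η·2logⁱY·G`**, `S_m = Σ_{k≤Y}|a(k)|ℓ⁺(k)^m`, `G = 𝒲(1) + 2 + |log α| + 2log Y`.

Def-free; theorems only. Helper `--supports stmt-Parity-20007`; closes nothing; K_A, K_B and the Parity summit are NOT
proved; nothing about Landau–Siegel zeros.

## References
* E. Kowalski, P. Michel, J. VanderKam, J. reine angew. Math. 526 (2000), (21)–(23) pp. 12–13 and Prop. 5.1 p. 18
  (the diagonal of the mollified second moment; the corner is the difference between the true cut-off `𝒲` and its
  residue). [cite: KowalskiMichelVanderKam2000, Prop. 5.1 — derivation (corner, general profile weights)]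
-/

noncomputable section

open Finset Real

namespace Summit.Parity.GeneralizedHardyLittlewood.Theorems.MomentsBeyondDiagonal.DiagCorner

open Summit.Parity.GeneralizedHardyLittlewood.Theorems.BeyondDiagonalBeatsQuarter.Corner

/-- **The two-variable Abel estimate for the corner double sum with log-power weights.** Let `a` be any real
sequence with `|Σ_{k≤e} a(k)| ≤ B` for all `e` and `|Σ_{k≤e} a(k)| ≤ η` for `e ≥ K₁`; let `Y ≥ 1`, `α > 0`,
`i, j ≥ 1`. Then
`|Σ_{k₁,k₂ ≤ Y} a(k₁)a(k₂)ℓ⁺(k₁)ⁱℓ⁺(k₂)ʲE(αk₁k₂)| ≤ Sᵢ·(B·(2logʲY·√(2αK₁Y))) + Sⱼ·(2η·(2logⁱY·G))`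
with `S_m = Σ_{k ≤ Y}|a(k)|ℓ⁺(k)^m` and `G = 𝒲(1) + 2 + |log α| + 2 log Y`.
[cite: KowalskiMichelVanderKam2000, Prop. 5.1 — derivation (corner of the diagonal, real-variable form, general weights)] -/
theorem abs_doubleSum_cornerE_pow_le {a : ℕ → ℝ} {Y α B η : ℝ} {K₁ i j : ℕ} (hY : 1 ≤ Y) (hα : 0 < α)
    (hi : 1 ≤ i) (hj : 1 ≤ j)
    (hB : ∀ e : ℕ, |∑ k ∈ Icc 1 e, a k| ≤ B) (hη : ∀ e : ℕ, K₁ ≤ e → |∑ k ∈ Icc 1 e, a k| ≤ η) :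
    |∑ k₁ ∈ Icc 1 ⌊Y⌋₊, ∑ k₂ ∈ Icc 1 ⌊Y⌋₊,
        a k₁ * a k₂ * ellp Y k₁ ^ i * ellp Y k₂ ^ j * cornerE (α * k₁ * k₂)| ≤
      (∑ k ∈ Icc 1 ⌊Y⌋₊, |a k| * ellp Y k ^ i) * (B * (2 * Real.log Y ^ j * Real.sqrt (2 * α * K₁ * Y))) +
        (∑ k ∈ Icc 1 ⌊Y⌋₊, |a k| * ellp Y k ^ j) *
          ((2 * η) * (2 * Real.log Y ^ i * (scriptW 1 + 2 + |Real.log α| + 2 * Real.log Y))) := by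
  have hY0 : 0 < Y := by linarith
  set N : ℕ := ⌊Y⌋₊ with hN
  have hN1 : 1 ≤ N := Nat.le_floor (by simpa using hY)
  have hNY : (N : ℝ) ≤ Y := Nat.floor_le hY0.le
  have hYN : Y < N + 1 := Nat.lt_floor_add_one Y
  have hN2Y : (N : ℝ) + 1 ≤ 2 * Y := by linarith
  have hLY : 0 ≤ Real.log Y := Real.log_nonneg hY
  set G : ℝ := scriptW 1 + 2 + |Real.log α| + 2 * Real.log Y with hGdef
  have hW : 0 ≤ scriptW 1 := scriptW_nonneg zero_le_one
  have hG0 : 0 ≤ G := by rw [hGdef]; positivity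
  have hB0 : 0 ≤ B := (abs_nonneg _).trans (hB 0)
  set A : ℕ → ℝ := fun e ↦ ∑ k ∈ Icc 1 e, a k with hAdef
  set Si : ℝ := ∑ k ∈ Icc 1 N, |a k| * ellp Y k ^ i with hSidef
  set Sj : ℝ := ∑ k ∈ Icc 1 N, |a k| * ellp Y k ^ j with hSjdef
  have hell0 : ∀ (m : ℕ) (e : ℕ), 0 ≤ ellp Y e ^ m := fun m e ↦ pow_nonneg (ellp_nonneg Y e) m
  have hSi0 : 0 ≤ Si := Finset.sum_nonneg fun k _ ↦ mul_nonneg (abs_nonneg _) (hell0 i k)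
  have hSj0 : 0 ≤ Sj := Finset.sum_nonneg fun k _ ↦ mul_nonneg (abs_nonneg _) (hell0 j k)
  -- the weight facts, for a general exponent `m ≥ 1`
  have hfF : ∀ (m : ℕ) (e : ℕ), ellp Y e ^ m ≤ Real.log Y ^ m := fun m e ↦
    pow_le_pow_left₀ (ellp_nonneg Y e) (ellp_le_log' hY e) m
  have hf : ∀ (m : ℕ) (e : ℕ), 0 < e → ellp Y (e + 1) ^ m ≤ ellp Y e ^ m := fun m e he ↦
    pow_le_pow_left₀ (ellp_nonneg Y _) (ellp_succ_le hY0.le he) m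
  have hfw : ∀ m : ℕ, 1 ≤ m → ellp Y (N + 1) ^ m = 0 := fun m hm ↦ by
    rw [ellp_eq_zero hY0.le le_rfl]; exact zero_pow (by omega)
  -- E along an arithmetic ray `e ↦ E(c e)`, `c > 0`
  have hE0 : ∀ c : ℝ, 0 < c → ∀ e : ℕ, 0 < e → 0 ≤ cornerE (c * e) := fun c hc e he ↦
    cornerE_nonneg (by positivity)
  have hEmono : ∀ c : ℝ, 0 < c → ∀ e : ℕ, 0 < e → cornerE (c * e) ≤ cornerE (c * (e + 1 : ℕ)) := by
    intro c hc e he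
    exact cornerE_mono (by positivity) (by push_cast; nlinarith)
  -- uniform size of E at arguments ≤ 2αY²
  have hEG : ∀ y : ℝ, 0 < y → y ≤ 2 * α * Y ^ 2 → cornerE y ≤ G := by
    intro y hy hyle
    rcases le_total y 1 with hy1 | hy1
    · have := cornerE_le_sqrt hy
      have h2 : Real.sqrt y ≤ 1 := Real.sqrt_le_one.mpr hy1
      rw [hGdef]
      have : 0 ≤ |Real.log α| := abs_nonneg _
      linarith
    · have h2 := cornerE_le_log hy1
      have hlogy : Real.log y ≤ Real.log 2 + Real.log α + 2 * Real.log Y := by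
        have := Real.log_le_log hy hyle
        rw [Real.log_mul (by positivity) (by positivity), Real.log_mul (by norm_num) hα.ne',
          Real.log_pow] at this
        push_cast at this
        linarith
      have hl2 : Real.log 2 ≤ 1 := by
        have := Real.log_two_lt_d9; linarith
      have hla : Real.log α ≤ |Real.log α| := le_abs_self _
      have hla' : 0 ≤ |Real.log α| := abs_nonneg _
      rw [hGdef]
      linarith
  -- split the outer sum at K' = min K₁ N
  set K' : ℕ := min K₁ N with hK'
  have hK'N : K' ≤ N := min_le_right _ _
  have hsplit : ∑ k₁ ∈ Icc 1 N, ∑ k₂ ∈ Icc 1 N,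
      a k₁ * a k₂ * ellp Y k₁ ^ i * ellp Y k₂ ^ j * cornerE (α * k₁ * k₂) =
      ∑ k₁ ∈ Icc 1 K', a k₁ * ellp Y k₁ ^ i *
          ∑ k₂ ∈ Ioc 0 N, a k₂ * (ellp Y k₂ ^ j * cornerE (α * k₁ * k₂)) +
        ∑ k₂ ∈ Icc 1 N, a k₂ * ellp Y k₂ ^ j *
          ∑ k₁ ∈ Ioc K' N, a k₁ * (ellp Y k₁ ^ i * cornerE (α * k₂ * k₁)) := by
    have hIcc : Icc 1 N = Icc 1 K' ∪ Ioc K' N := by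
      ext k; simp only [Finset.mem_union, Finset.mem_Icc, Finset.mem_Ioc]; omega
    have hdisj : Disjoint (Icc 1 K') (Ioc K' N) := by
      rw [Finset.disjoint_left]; intro k hk hk'
      simp only [Finset.mem_Icc, Finset.mem_Ioc] at hk hk'; omega
    conv_lhs => arg 1; rw [hIcc]
    rw [Finset.sum_union hdisj]
    congr 1
    · refine Finset.sum_congr rfl fun k₁ _ ↦ ?_
      rw [Finset.mul_sum, ← Literature.Barriers.Parity.Icc_one_eq_Ioc_zero]
      exact Finset.sum_congr rfl fun k₂ _ ↦ by ring
    · rw [Finset.sum_comm]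
      refine Finset.sum_congr rfl fun k₂ _ ↦ ?_
      rw [Finset.mul_sum]
      refine Finset.sum_congr rfl fun k₁ _ ↦ ?_
      rw [show α * (k₂ : ℝ) * k₁ = α * k₁ * k₂ by ring]
      ring
  rw [hsplit]
  -- Part 1: rows k₁ ≤ K' (weight `ℓ⁺(k₂)ʲ` in the inner variable)
  have hpart1 : ∀ k₁ ∈ Icc 1 K',
      |∑ k₂ ∈ Ioc 0 N, a k₂ * (ellp Y k₂ ^ j * cornerE (α * k₁ * k₂))| ≤
        B * (2 * Real.log Y ^ j * Real.sqrt (2 * α * K₁ * Y)) := by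
    intro k₁ hk₁
    have hk₁' := Finset.mem_Icc.1 hk₁
    have hk₁0 : (0 : ℝ) < k₁ := by exact_mod_cast hk₁'.1
    have hk₁K : (k₁ : ℝ) ≤ K₁ := by exact_mod_cast hk₁'.2.trans (min_le_left _ _)
    have hc : 0 < α * k₁ := by positivity
    have hH : ∀ e : ℕ, 0 < e → e ≤ N + 1 → cornerE (α * k₁ * e) ≤ Real.sqrt (2 * α * K₁ * Y) := by
      intro e he heN
      have hpos : 0 < α * k₁ * e := by positivity
      refine (cornerE_le_sqrt hpos).trans (Real.sqrt_le_sqrt ?_)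
      have heY : (e : ℝ) ≤ 2 * Y := by
        have : (e : ℝ) ≤ N + 1 := by exact_mod_cast heN
        linarith
      calc α * k₁ * e ≤ α * K₁ * (2 * Y) := by gcongr
        _ = 2 * α * K₁ * Y := by ring
    have := abs_sum_Ioc_mul_prod_le a (Nat.zero_le N) (B := B) (F := Real.log Y ^ j)
      (H := Real.sqrt (2 * α * K₁ * Y)) (f := fun e ↦ ellp Y e ^ j) (h := fun e ↦ cornerE (α * k₁ * e))
      hB0 (fun e _ _ ↦ by
        rw [Finset.Icc_eq_empty (show ¬ (1 : ℕ) ≤ 0 by norm_num), Finset.sum_empty, sub_zero]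
        exact hB e)
      (hell0 j) (hfF j) (fun e he ↦ hf j e he) (hfw j hj)
      (fun e he ↦ hE0 (α * k₁) hc e he) (fun e he heN ↦ hH e he heN)
      (fun e he ↦ hEmono (α * k₁) hc e he)
    exact this
  -- Part 2: columns, Abel in k₁ over (K', N] (weight `ℓ⁺(k₁)ⁱ`)
  have hη0 : 0 ≤ η := (abs_nonneg _).trans (hη K₁ le_rfl)
  have hpart2 : ∀ k₂ ∈ Icc 1 N,
      |∑ k₁ ∈ Ioc K' N, a k₁ * (ellp Y k₁ ^ i * cornerE (α * k₂ * k₁))| ≤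
        (2 * η) * (2 * Real.log Y ^ i * G) := by
    intro k₂ hk₂
    have hk₂' := Finset.mem_Icc.1 hk₂
    have hk₂0 : (0 : ℝ) < k₂ := by exact_mod_cast hk₂'.1
    have hk₂N : (k₂ : ℝ) ≤ N := by exact_mod_cast hk₂'.2
    have hc : 0 < α * k₂ := by positivity
    rcases eq_or_lt_of_le hK'N with hKN | hKN
    · rw [hKN]; simp only [Finset.Ioc_self, Finset.sum_empty, abs_zero]
      positivity
    have hK'K : K' = K₁ := by omega
    have hη2 : ∀ e, K' < e → e ≤ N → |A e - A K'| ≤ 2 * η := by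
      intro e he _
      rw [hK'K] at he ⊢
      calc |A e - A K₁| ≤ |A e| + |A K₁| := abs_sub _ _
        _ ≤ η + η := add_le_add (hη e he.le) (hη K₁ le_rfl)
        _ = 2 * η := by ring
    have hH : ∀ e : ℕ, 0 < e → e ≤ N + 1 → cornerE (α * k₂ * e) ≤ G := by
      intro e he heN
      refine hEG _ (by positivity) ?_
      have heY : (e : ℝ) ≤ 2 * Y := by
        have : (e : ℝ) ≤ N + 1 := by exact_mod_cast heN
        linarith
      calc α * k₂ * e ≤ α * Y * (2 * Y) := by gcongr; exact hk₂N.trans hNY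
        _ = 2 * α * Y ^ 2 := by ring
    have := abs_sum_Ioc_mul_prod_le a hK'N (B := 2 * η) (F := Real.log Y ^ i) (H := G)
      (f := fun e ↦ ellp Y e ^ i) (h := fun e ↦ cornerE (α * k₂ * e))
      (by positivity) (fun e he heN ↦ hη2 e he heN) (hell0 i) (hfF i) (fun e he ↦ hf i e (by omega))
      (hfw i hi)
      (fun e he ↦ hE0 (α * k₂) hc e (by omega)) (fun e he heN ↦ hH e (by omega) heN)
      (fun e he ↦ hEmono (α * k₂) hc e (by omega))
    exact this
  -- assemble
  have hS' : ∑ k ∈ Icc 1 K', |a k| * ellp Y k ^ i ≤ Si := by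
    rw [hSidef]
    exact Finset.sum_le_sum_of_subset_of_nonneg (Finset.Icc_subset_Icc_right hK'N)
      (fun k _ _ ↦ mul_nonneg (abs_nonneg _) (hell0 i k))
  have h1 : |∑ k₁ ∈ Icc 1 K', a k₁ * ellp Y k₁ ^ i *
      ∑ k₂ ∈ Ioc 0 N, a k₂ * (ellp Y k₂ ^ j * cornerE (α * k₁ * k₂))| ≤
      Si * (B * (2 * Real.log Y ^ j * Real.sqrt (2 * α * K₁ * Y))) := by
    calc |∑ k₁ ∈ Icc 1 K', a k₁ * ellp Y k₁ ^ i *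
          ∑ k₂ ∈ Ioc 0 N, a k₂ * (ellp Y k₂ ^ j * cornerE (α * k₁ * k₂))|
        ≤ ∑ k₁ ∈ Icc 1 K', |a k₁ * ellp Y k₁ ^ i *
          ∑ k₂ ∈ Ioc 0 N, a k₂ * (ellp Y k₂ ^ j * cornerE (α * k₁ * k₂))| :=
          Finset.abs_sum_le_sum_abs _ _
      _ ≤ ∑ k₁ ∈ Icc 1 K', |a k₁| * ellp Y k₁ ^ i * (B * (2 * Real.log Y ^ j * Real.sqrt (2 * α * K₁ * Y))) := by
          refine Finset.sum_le_sum fun k₁ hk₁ ↦ ?_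
          rw [abs_mul, abs_mul, abs_of_nonneg (hell0 i k₁)]
          exact mul_le_mul_of_nonneg_left (hpart1 k₁ hk₁) (mul_nonneg (abs_nonneg _) (hell0 i k₁))
      _ = (∑ k₁ ∈ Icc 1 K', |a k₁| * ellp Y k₁ ^ i) * (B * (2 * Real.log Y ^ j * Real.sqrt (2 * α * K₁ * Y))) := by
          rw [Finset.sum_mul]
      _ ≤ Si * (B * (2 * Real.log Y ^ j * Real.sqrt (2 * α * K₁ * Y))) :=
          mul_le_mul_of_nonneg_right hS' (by positivity)
  have h2 : |∑ k₂ ∈ Icc 1 N, a k₂ * ellp Y k₂ ^ j *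
      ∑ k₁ ∈ Ioc K' N, a k₁ * (ellp Y k₁ ^ i * cornerE (α * k₂ * k₁))| ≤
      Sj * ((2 * η) * (2 * Real.log Y ^ i * G)) := by
    calc |∑ k₂ ∈ Icc 1 N, a k₂ * ellp Y k₂ ^ j *
          ∑ k₁ ∈ Ioc K' N, a k₁ * (ellp Y k₁ ^ i * cornerE (α * k₂ * k₁))|
        ≤ ∑ k₂ ∈ Icc 1 N, |a k₂ * ellp Y k₂ ^ j *
          ∑ k₁ ∈ Ioc K' N, a k₁ * (ellp Y k₁ ^ i * cornerE (α * k₂ * k₁))| :=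
          Finset.abs_sum_le_sum_abs _ _
      _ ≤ ∑ k₂ ∈ Icc 1 N, |a k₂| * ellp Y k₂ ^ j * ((2 * η) * (2 * Real.log Y ^ i * G)) := by
          refine Finset.sum_le_sum fun k₂ hk₂ ↦ ?_
          rw [abs_mul, abs_mul, abs_of_nonneg (hell0 j k₂)]
          exact mul_le_mul_of_nonneg_left (hpart2 k₂ hk₂) (mul_nonneg (abs_nonneg _) (hell0 j k₂))
      _ = Sj * ((2 * η) * (2 * Real.log Y ^ i * G)) := by rw [Finset.sum_mul]
  exact (abs_add_le _ _).trans (add_le_add h1 h2)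

end Summit.Parity.GeneralizedHardyLittlewood.Theorems.MomentsBeyondDiagonal.DiagCorner

end
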